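import Mathlib

/-!
# Crux `RtdLocal` (stmt-ResolutionOfSingularities-18840), line `Sketch` — stub `stub_gl`

`GL_J(k)` acts on typed straighteners. Write `H := k⟦t^ℚ⟧ = HahnSeries ℚ k`, `v := orderTop`.
An invertible CONSTANT matrix `M : Matrix J J k` acts on `H^J` through `M_H := M.map HahnSeries.C`.
If the coordinate family `c : ι → J → H` admits a typed straightener `(W, φ)` of rank `≥ r`
(clauses: (1) rv-straightening, (2) positivity, (3) `W`-translation invariance, `W ≤ k^J` a space
of constant directions), then so does `M_H • c`, with witness `W' := M W`, `φ' a := M_H *ᵥ φ a`.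

The only analytic input is that constant matrices do not lower orders:
`v((M_H *ᵥ x) i) ≥ min_j v(x j)` (and strictly above any `μ ≠ ⊤` lying strictly below all
`v(x j)`), applied to `M_H` and to its inverse `M⁻¹_H`.

Helper lemmas are prefixed `gl_`. No definitions, no named facts (Mathlib only).
-/

set_option linter.dupNamespace false

namespace Summit.ResolutionOfSingularities.ResolutionOfSingularities.Theorems

/-- A finite sum of Hahn series of order `≥ μ` has order `≥ μ` (ultrametric inequality). -/
theorem gl_le_orderTop_sum {k : Type} [Field k] {J : Type} (s : Finset J)
    (f : J → HahnSeries ℚ k) (μ : WithTop ℚ) (hf : ∀ j ∈ s, μ ≤ (f j).orderTop) :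
    μ ≤ (∑ j ∈ s, f j).orderTop := by
  classical
  induction s using Finset.induction_on with
  | empty => simp
  | insert a s ha ih =>
    rw [Finset.sum_insert ha]
    refine le_trans ?_ HahnSeries.min_orderTop_le_orderTop_add
    exact le_min (hf a (Finset.mem_insert_self a s))
      (ih fun j hj => hf j (Finset.mem_insert_of_mem hj))

/-- A finite sum of Hahn series of order `> μ`, `μ ≠ ⊤`, has order `> μ`. -/
theorem gl_lt_orderTop_sum {k : Type} [Field k] {J : Type} (s : Finset J)
    (f : J → HahnSeries ℚ k) (μ : WithTop ℚ) (hμ : μ ≠ ⊤) (hf : ∀ j ∈ s, μ < (f j).orderTop) :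
    μ < (∑ j ∈ s, f j).orderTop := by
  classical
  induction s using Finset.induction_on with
  | empty => simpa [lt_top_iff_ne_top] using hμ
  | insert a s ha ih =>
    rw [Finset.sum_insert ha]
    refine lt_of_lt_of_le ?_ HahnSeries.min_orderTop_le_orderTop_add
    exact lt_min (hf a (Finset.mem_insert_self a s))
      (ih fun j hj => hf j (Finset.mem_insert_of_mem hj))

/-- Constant matrices do not lower orders: if all `v(x j) ≥ μ` then all
`v((N_H *ᵥ x) i) ≥ μ`, where `N_H := N.map HahnSeries.C`. -/
theorem gl_le_orderTop_mulVec {k : Type} [Field k] {J : Type} [Fintype J]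
    (N : Matrix J J k) (x : J → HahnSeries ℚ k) (μ : WithTop ℚ)
    (hx : ∀ j, μ ≤ (x j).orderTop) (i : J) :
    μ ≤ ((N.map HahnSeries.C).mulVec x i).orderTop := by
  simp only [Matrix.mulVec, dotProduct, Matrix.map_apply, HahnSeries.C_mul_eq_smul]
  exact gl_le_orderTop_sum _ _ _ fun j _ =>
    (hx j).trans (HahnSeries.orderTop_le_orderTop_smul _ _)

/-- Strict version: if `μ ≠ ⊤` and all `v(x j) > μ` then all `v((N_H *ᵥ x) i) > μ`. -/
theorem gl_lt_orderTop_mulVec {k : Type} [Field k] {J : Type} [Fintype J]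
    (N : Matrix J J k) (x : J → HahnSeries ℚ k) (μ : WithTop ℚ) (hμ : μ ≠ ⊤)
    (hx : ∀ j, μ < (x j).orderTop) (i : J) :
    μ < ((N.map HahnSeries.C).mulVec x i).orderTop := by
  simp only [Matrix.mulVec, dotProduct, Matrix.map_apply, HahnSeries.C_mul_eq_smul]
  exact gl_lt_orderTop_sum _ _ _ hμ fun j _ =>
    (hx j).trans_le (HahnSeries.orderTop_le_orderTop_smul _ _)

/-- For an invertible constant matrix `M`, `M⁻¹_H` is a two-sided inverse of `M_H`. -/
theorem gl_map_inv_mul_map {k : Type} [Field k] {J : Type} [Fintype J] [DecidableEq J]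
    (M : Matrix J J k) (hM : IsUnit M.det) :
    (M⁻¹.map HahnSeries.C : Matrix J J (HahnSeries ℚ k)) * M.map HahnSeries.C = 1 ∧
      (M.map HahnSeries.C : Matrix J J (HahnSeries ℚ k)) * M⁻¹.map HahnSeries.C = 1 := by
  have h1 : ∀ N : Matrix J J k, (N.map HahnSeries.C : Matrix J J (HahnSeries ℚ k)) =
      (HahnSeries.C : k →+* HahnSeries ℚ k).mapMatrix N := fun N => rfl
  refine ⟨?_, ?_⟩
  · rw [h1, h1, ← map_mul, Matrix.nonsing_inv_mul _ hM, map_one]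
  · rw [h1, h1, ← map_mul, Matrix.mul_nonsing_inv _ hM, map_one]

/-- GL: an invertible CONSTANT matrix `M ∈ GL_J(k)` (acting on `H^J` through `HahnSeries.C`)
transports a typed straightener for `c` to one for `M • c` (`φ' := M φ`, `W' := M W`). -/
theorem stub_gl {k : Type} [Field k] {ι J : Type} [Fintype J] [DecidableEq J]
    (c : ι → J → HahnSeries ℚ k) (M : Matrix J J k) (hM : IsUnit M.det) (r : ℕ)
    (h : ∃ W : Submodule k (J → k), r ≤ Module.finrank k W ∧
      ∃ φ : ι → J → HahnSeries ℚ k,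
        (∀ a b, a ≠ b → ∃ j, ∀ i,
          (c a j - c b j).orderTop < ((φ a i - φ b i) - (c a i - c b i)).orderTop) ∧
        (∀ a i, 0 < (φ a i).orderTop) ∧
        (∀ a (w : J → HahnSeries ℚ k), (∀ i, 0 < (w i).orderTop) →
          w ∈ Submodule.span (HahnSeries ℚ k)
            ((fun u : J → k => fun i => HahnSeries.C (u i)) '' (W : Set (J → k))) →
          ∃ b, φ b = φ a + w)) :
    ∃ W : Submodule k (J → k), r ≤ Module.finrank k W ∧
      ∃ φ : ι → J → HahnSeries ℚ k,
        (∀ a b, a ≠ b → ∃ j, ∀ i,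
          ((M.map HahnSeries.C).mulVec (c a) j - (M.map HahnSeries.C).mulVec (c b) j).orderTop <
            ((φ a i - φ b i) -
              ((M.map HahnSeries.C).mulVec (c a) i - (M.map HahnSeries.C).mulVec (c b) i)).orderTop) ∧
        (∀ a i, 0 < (φ a i).orderTop) ∧
        (∀ a (w : J → HahnSeries ℚ k), (∀ i, 0 < (w i).orderTop) →
          w ∈ Submodule.span (HahnSeries ℚ k)
            ((fun u : J → k => fun i => HahnSeries.C (u i)) '' (W : Set (J → k))) →
          ∃ b, φ b = φ a + w) := by
  obtain ⟨W, hW, φ, h1, h2, h3⟩ := h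
  obtain ⟨hinv_mul, hmul_inv⟩ := gl_map_inv_mul_map M hM
  -- the constant matrix and its inverse, read in `H`
  set MH : Matrix J J (HahnSeries ℚ k) := M.map HahnSeries.C with hMH
  set Minv : Matrix J J (HahnSeries ℚ k) := M⁻¹.map HahnSeries.C with hMinv
  have hleft : ∀ x : J → HahnSeries ℚ k, Minv.mulVec (MH.mulVec x) = x := fun x => by
    rw [Matrix.mulVec_mulVec, hinv_mul, Matrix.one_mulVec]
  have hright : ∀ x : J → HahnSeries ℚ k, MH.mulVec (Minv.mulVec x) = x := fun x => by
    rw [Matrix.mulVec_mulVec, hmul_inv, Matrix.one_mulVec]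
  refine ⟨W.map (Matrix.toLin' M), ?_, fun a => MH.mulVec (φ a), ?_, ?_, ?_⟩
  · -- rank: `toLin' M` is injective
    have hinj : Function.Injective (Matrix.toLin' M) := by
      intro u u' huu'
      have key := congrArg (fun x => M⁻¹.mulVec x) huu'
      simpa only [Matrix.toLin'_apply, Matrix.mulVec_mulVec, Matrix.nonsing_inv_mul _ hM,
        Matrix.one_mulVec] using key
    exact hW.trans (Submodule.equivMapOfInjective _ hinj W).finrank_eq.le
  · -- clause (1): rv-straightening
    intro a b hab
    obtain ⟨j, hj⟩ := h1 a b hab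
    set Δ : J → HahnSeries ℚ k := c a - c b with hΔ
    set err : J → HahnSeries ℚ k := (φ a - φ b) - Δ with herr
    have hne : (Finset.univ : Finset J).Nonempty := ⟨j, Finset.mem_univ j⟩
    obtain ⟨j₀, -, hj₀⟩ := Finset.exists_min_image Finset.univ (fun i => (Δ i).orderTop) hne
    have hμerr : ∀ i, (Δ j₀).orderTop < (err i).orderTop := fun i =>
      (hj₀ j (Finset.mem_univ j)).trans_lt (hj i)
    have hμtop : (Δ j₀).orderTop ≠ ⊤ := by
      intro htop
      have := hμerr j
      rw [htop] at this
      exact not_top_lt this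
    -- an index where the transformed difference has order `≤ v(Δ j₀)`
    have hidx : ∃ j', ((MH.mulVec Δ) j').orderTop ≤ (Δ j₀).orderTop := by
      by_contra hcon
      push Not at hcon
      have h' : (Δ j₀).orderTop < ((Minv.mulVec (MH.mulVec Δ)) j₀).orderTop :=
        gl_lt_orderTop_mulVec M⁻¹ (MH.mulVec Δ) _ hμtop hcon j₀
      rw [hleft] at h'
      exact lt_irrefl _ h'
    obtain ⟨j', hj'⟩ := hidx
    refine ⟨j', fun i => ?_⟩
    have e1 : MH.mulVec (c a) j' - MH.mulVec (c b) j' = (MH.mulVec Δ) j' := by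
      rw [hΔ, Matrix.mulVec_sub, Pi.sub_apply]
    have e2 : (MH.mulVec (φ a) i - MH.mulVec (φ b) i) - (MH.mulVec (c a) i - MH.mulVec (c b) i) =
        (MH.mulVec err) i := by
      rw [herr, hΔ, Matrix.mulVec_sub, Matrix.mulVec_sub, Matrix.mulVec_sub]
      rfl
    rw [e1, e2]
    exact hj'.trans_lt (gl_lt_orderTop_mulVec M err _ hμtop hμerr i)
  · -- clause (2): positivity
    intro a i
    exact gl_lt_orderTop_mulVec M (φ a) 0 WithTop.zero_ne_top (h2 a) i
  · -- clause (3): translation invariance along `W' := M W`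
    intro a w hw hmem
    have himg : ((fun u : J → k => fun i => HahnSeries.C (u i)) ''
        (W.map (Matrix.toLin' M) : Set (J → k))) =
        (Matrix.toLin' MH) ''
          ((fun u : J → k => fun i => HahnSeries.C (u i)) '' (W : Set (J → k))) := by
      rw [Submodule.map_coe, Set.image_image, Set.image_image]
      refine Set.image_congr fun u _ => ?_
      funext i
      simp only [Matrix.toLin'_apply]
      exact RingHom.map_mulVec HahnSeries.C M u i
    rw [himg, Submodule.span_image] at hmem
    obtain ⟨w₀, hw₀, hw₀w⟩ := Submodule.mem_map.mp hmem
    rw [Matrix.toLin'_apply] at hw₀w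
    have hw₀' : w₀ = Minv.mulVec w := by rw [← hw₀w, hleft]
    have hw₀pos : ∀ i, 0 < (w₀ i).orderTop := fun i => by
      rw [hw₀']
      exact gl_lt_orderTop_mulVec M⁻¹ w 0 WithTop.zero_ne_top hw i
    obtain ⟨b, hb⟩ := h3 a w₀ hw₀pos hw₀
    refine ⟨b, ?_⟩
    show MH.mulVec (φ b) = MH.mulVec (φ a) + w
    rw [hb, Matrix.mulVec_add, hw₀w]

end Summit.ResolutionOfSingularities.ResolutionOfSingularities.Theorems
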